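import Literature.Computability.Complexity.Transducers
import Literature.Computability.Complexity.TM2Iterate
import Literature.Computability.Complexity.UnaryArithMachines
import Literature.Computability.Complexity.PairingMachines
import Literature.Computability.Complexity.MapFstMachine
import Literature.Computability.Complexity.ReductionsProofs
import HarnessLib

/-!
# Copying a string, `z ↦ ⟨z, z⟩`, is polynomial time; `P` is closed under `∩` and `∪` (trunk CplxCore)

Machine-level infrastructure, assembled — as in `CoinTruncation.lean` — from the tree's `FinTM2`
toolkit without programming a new Turing machine: finite-state transducers (`Transducers.lean`),
the clocked-iteration combinator (`TM2Iterate.lean`), the unary clock `initFn` and the re-pairing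
normaliser `rePair` (`UnaryArithMachines.lean`, `PairingMachines.lean`), and composition.

* `copyFn ∈ FP` with `copyFn z = boolPair z z` (`copyFn_apply`): end-mark the input
  (`z ↦ ⟨z, []⟩ = rePair (dup z)`), prefix the clock `1^{|z|}` (`initFn`), recode into cells
  (`copyInit`), run `|z|` rounds of the transducer `copyStep`, each of which carries the first unsent
  symbol to the end of the copy region (in front of the end marker), and decode (`copyOut`).
* Consequences (Arora–Barak 2009, §1.3/Claim 1.6 spirit: "run both machines"): for a class `K`
  closed under polynomial-time preimages and containing `P`, and `L₁ ∈ P`, `L₂ ∈ K`: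
  `L₁ ∩ L₂ ∈ K` and `L₁ ∪ L₂ ∈ K` (`inter_mem_of_preimage_closed`, `union_mem_of_preimage_closed`) —
  copy the input, evaluate the indicator of `L₁` on the first copy (`mapFstFn`), and let a
  transducer select the second copy or a fixed string outside/inside `L₂`. In particular
  `inter_mem_P`, `union_mem_P` (`P` is closed under intersection and union).

## References

* S. Arora, B. Barak, *Computational Complexity: A Modern Approach*, CUP 2009, §0.1 (pairing),
  §1.3 (machine constructions), Claim 1.6, §1.4.1 (clocked simulation), Thm. 2.8 (composition).
* J. E. Hopcroft, J. D. Ullman, *Introduction to Automata Theory, Languages, and Computation*, 1979,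
  §2.7 (Mealy machines).
-/

namespace Literature.Computability.Complexity

open _root_.Computability

namespace StrCopy

/-! ### Doubling and end-marking -/

/-- `dup z`: every symbol doubled (the first component of `boolPair z y`). [Arora–Barak 2009, §0.1] [cite: AroraBarak2009, §0.1] -/
def dup (z : List Bool) : List Bool :=
  z.flatMap fun b => [b, b]

/-- `boolPair z y = dup z ++ 0 1 y`. [Arora–Barak 2009, §0.1] [cite: AroraBarak2009, §0.1] -/
theorem boolPair_eq_dup (z y : List Bool) : boolPair z y = dup z ++ false :: true :: y := by
  simp [boolPair, dup]

/-- The decoder reads a doubled string without separator as `(z, [])`. [Arora–Barak 2009, §0.1] [cite: AroraBarak2009, §0.1] -/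
theorem boolUnpair_dup (z : List Bool) : boolUnpair (dup z) = (z, []) := by
  induction z with
  | nil => rfl
  | cons b z ih =>
    simp only [dup, List.flatMap_cons] at ih ⊢
    simp [boolUnpair, ih]

/-- The one-state doubling transducer. [folklore] -/
def dupT : FST Unit Bool Bool where
  init := ()
  step := fun _ b => ((), [b, b])
  front := fun _ => []
  keep := fun _ => true

/-- `dupT` computes `dup`. [folklore] -/
theorem dupT_eval (z : List Bool) : dupT.eval z = dup z := by
  have h : ∀ z : List Bool, (dupT.run () z).2 = dup z := by
    intro z
    induction z with
    | nil => rfl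
    | cons b z ih => simpa [FST.run_cons, dupT, dup] using ih
  have he : dupT.eval z = (dupT.run () z).2 := by simp [FST.eval, dupT]
  rw [he, h z]

/-- `dup ∈ FP`. [folklore] -/
theorem dup_mem_FP : dup ∈ FP := by
  have h : dup = dupT.eval := funext fun z => (dupT_eval z).symm
  rw [h]
  exact dupT.polyTimeComputable_eval

/-- **End-marking is polynomial time**: `z ↦ ⟨z, []⟩ = rePair (dup z)` is in `FP`. [Arora–Barak 2009, §0.1, §1.3] [cite: AroraBarak2009, §0.1] -/
theorem rePair_dup (z : List Bool) : rePair (dup z) = boolPair z [] := by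
  simp [rePair, boolUnpair_dup]

/-! ### Configurations of the copy loop -/

/-- The loop configuration after the prefix `done` has been copied and `rest` is still unsent:
source cells `1 1 b` (sent) / `1 0 b` (unsent), the marker `0`, the copy region as cells `1 b`,
and the end marker `0`. [folklore] -/
def cfg (done rest : List Bool) : List Bool :=
  (done.flatMap fun b => [true, true, b]) ++ (rest.flatMap fun b => [true, false, b]) ++
    false :: ((done.flatMap fun b => [true, b]) ++ [false])

/-! ### Stage 2: recoding into the loop format, `copyInit` -/

/-- States of `copyInit`: clock conversion, the second block terminator, the pair reader, and the
final state after the end mark. [folklore] -/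
inductive S₂
  | cnt
  | z1
  | ev
  | od (b : Bool)
  | fin
  deriving DecidableEq, Fintype

/-- Transition function of `copyInit`. [folklore] -/
def copyInitStep : S₂ → Bool → S₂ × List (Option Bool)
  | .cnt, true => (.cnt, [none])
  | .cnt, false => (.z1, [])
  | .z1, true => (.z1, [])
  | .z1, false => (.ev, [])
  | .ev, b => (.od b, [])
  | .od b, b' => if b = b' then (.ev, [some true, some false, some b])
      else (.fin, [some false, some false])
  | .fin, _ => (.fin, [])

/-- The recoding transducer `1ⁿ 0 0 ⟨z, []⟩ ↦ noneⁿ ++ (cfg [] z).map some`. [folklore] -/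
def copyInit : FST S₂ Bool (Option Bool) where
  init := .cnt
  step := copyInitStep
  front := fun _ => []
  keep := fun _ => true

/-- The transition of `copyInit` is `copyInitStep` (definitional). [folklore] -/
@[simp] theorem copyInit_step (s : S₂) (b : Bool) : copyInit.step s b = copyInitStep s b := rfl

/-- The body emitted from state `ev`, as a plain function. [folklore] -/
def evPart : List Bool → List Bool
  | b :: b' :: w => if b = b' then true :: false :: b :: evPart w else [false, false]
  | _ => []

/-- The body emitted from state `z1`, as a plain function. [folklore] -/
def z1Part : List Bool → List Bool
  | true :: w => z1Part w
  | false :: w => evPart w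
  | [] => []

/-- Payload/count decomposition of the output of `copyInit` on an arbitrary input. [folklore] -/
def stage2 (w : List Bool) : List Bool × ℕ :=
  (z1Part (splitOnes w).2, (splitOnes w).1)

/-- From `fin` nothing is emitted. [folklore] -/
theorem copyInit_run_fin (w : List Bool) : (copyInit.run .fin w).2 = [] := by
  induction w with
  | nil => rfl
  | cons b w ih => simp [FST.run_cons, copyInitStep, ih]

/-- From `ev` the transducer emits `(evPart w).map some`. [folklore] -/
theorem copyInit_run_ev : ∀ w : List Bool, (copyInit.run .ev w).2 = (evPart w).map some
  | [] => rfl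
  | [b] => by simp [FST.run_cons, copyInitStep, evPart]
  | b :: b' :: w => by
    by_cases h : b = b'
    · subst h
      simp [FST.run_cons, copyInitStep, evPart, copyInit_run_ev w]
    · simp [FST.run_cons, copyInitStep, evPart, h, copyInit_run_fin]

/-- From `z1` the transducer emits `(z1Part w).map some`. [folklore] -/
theorem copyInit_run_z1 (w : List Bool) : (copyInit.run .z1 w).2 = (z1Part w).map some := by
  induction w with
  | nil => rfl
  | cons b w ih =>
    cases b
    · simp [FST.run_cons, copyInitStep, z1Part, copyInit_run_ev]
    · simpa [FST.run_cons, copyInitStep, z1Part] using ih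

/-- **Shape of the output of `copyInit` on every input**: `none`s first, then the payload. [folklore] -/
theorem copyInit_eval (w : List Bool) :
    copyInit.eval w = List.replicate (stage2 w).2 none ++ ((stage2 w).1).map some := by
  have h : ∀ w : List Bool, (copyInit.run .cnt w).2 =
      List.replicate (splitOnes w).1 none ++ (z1Part (splitOnes w).2).map some := by
    intro w
    induction w with
    | nil => rfl
    | cons b w ih =>
      cases b
      · simp [FST.run_cons, copyInitStep, splitOnes, copyInit_run_z1]
      · simp [FST.run_cons, copyInitStep, splitOnes, ih, List.replicate_succ]
  have he : copyInit.eval w = (copyInit.run .cnt w).2 := by simp [FST.eval, copyInit]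
  rw [he, h w, stage2]

/-- `evPart ⟨z, []⟩ = cfg [] z`. [folklore] -/
theorem evPart_boolPair_nil (z : List Bool) : evPart (boolPair z []) = cfg [] z := by
  induction z with
  | nil => simp [boolPair, evPart, cfg]
  | cons b z ih =>
    have hc : boolPair (b :: z) [] = b :: b :: boolPair z [] := by simp [boolPair]
    rw [hc, evPart, if_pos rfl, ih]
    simp [cfg]

/-- On the well-formed input `1ⁿ 0 0 ⟨z, []⟩` the decomposition is `(cfg [] z, n)`. [folklore] -/
theorem stage2_hdr (n : ℕ) (z : List Bool) : stage2 (hdr n 0 (boolPair z [])) = (cfg [] z, n) := by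
  simp [stage2, hdr, z1Part, evPart_boolPair_nil]

/-- `stage2` is polynomial-time computable into the input encoding of the iteration combinator. [folklore] -/
theorem polyTimeComputable_stage2 :
    PolyTimeComputable (id : List Bool → List Bool)
      (fun q : List Bool × ℕ => List.replicate q.2 none ++ (id q.1).map some) stage2 := by
  obtain ⟨p, M, hM⟩ := copyInit.polyTimeComputable_eval
  refine ⟨p, M, fun w => ?_⟩
  have h := hM w
  simp only [id, copyInit_eval] at h ⊢
  exact h

/-! ### Stage 3: one copy round, `copyStep` -/

/-- States of `copyStep`: source-cell reader before the carry (`s0`, `s1`, `s2 m`), after picking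
up the carried symbol `c` (`t0 c`, `t1 c`, `t2 c m`), the copy region without carry (`c0`, `c1`)
and with carry (`d0 c`, `d1 c`), and the final state. [folklore] -/
inductive S₃
  | s0
  | s1
  | s2 (m : Bool)
  | t0 (c : Bool)
  | t1 (c : Bool)
  | t2 (c m : Bool)
  | c0
  | c1
  | d0 (c : Bool)
  | d1 (c : Bool)
  | fin
  deriving DecidableEq, Fintype

/-- Transition function of `copyStep`. [folklore] -/
def copyStepStep : S₃ → Bool → S₃ × List Bool
  | .s0, true => (.s1, [])
  | .s0, false => (.c0, [false])
  | .s1, m => (.s2 m, [])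
  | .s2 true, b => (.s0, [true, true, b])
  | .s2 false, b => (.t0 b, [true, true, b])
  | .t0 c, true => (.t1 c, [])
  | .t0 c, false => (.d0 c, [false])
  | .t1 c, m => (.t2 c m, [])
  | .t2 c m, b => (.t0 c, [true, m, b])
  | .c0, true => (.c1, [])
  | .c0, false => (.fin, [false])
  | .c1, b => (.c0, [true, b])
  | .d0 c, true => (.d1 c, [])
  | .d0 c, false => (.fin, [true, c, false])
  | .d1 c, b => (.d0 c, [true, b])
  | .fin, _ => (.fin, [])

/-- One copy round: mark the first unsent source symbol as sent and append it, as a cell, in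
front of the end marker. [folklore] -/
def copyStep : FST S₃ Bool Bool where
  init := .s0
  step := copyStepStep
  front := fun _ => []
  keep := fun _ => true

/-- The transition of `copyStep` is `copyStepStep` (definitional). [folklore] -/
@[simp] theorem copyStep_step (s : S₃) (b : Bool) : copyStep.step s b = copyStepStep s b := rfl

/-- The transduction of `copyStep` is the body emitted from `s0`. [folklore] -/
@[simp] theorem copyStep_eval_eq (w : List Bool) : copyStep.eval w = (copyStep.run .s0 w).2 := by
  simp [FST.eval, copyStep]

/-- Copy region without carry: cells are copied and the end marker closes the output. [folklore] -/
theorem copyStep_run_c0 (l : List Bool) :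
    (copyStep.run .c0 ((l.flatMap fun b => [true, b]) ++ [false])).2 =
      (l.flatMap fun b => [true, b]) ++ [false] := by
  induction l with
  | nil => simp [FST.run_cons, copyStepStep]
  | cons b l ih => simp [FST.run_cons, copyStepStep, ih]

/-- Copy region with carry `c`: cells are copied and the cell `1 c` is inserted in front of the
end marker. [folklore] -/
theorem copyStep_run_d0 (c : Bool) (l : List Bool) :
    (copyStep.run (.d0 c) ((l.flatMap fun b => [true, b]) ++ [false])).2 =
      (l.flatMap fun b => [true, b]) ++ [true, c, false] := by
  induction l with
  | nil => simp [FST.run_cons, copyStepStep]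
  | cons b l ih => simp [FST.run_cons, copyStepStep, ih]

/-- After the carry has been picked up, the remaining unsent cells are copied. [folklore] -/
theorem copyStep_run_t0 (c : Bool) (l w : List Bool) :
    (copyStep.run (.t0 c) ((l.flatMap fun b => [true, false, b]) ++ false :: w)).2 =
      (l.flatMap fun b => [true, false, b]) ++ false :: (copyStep.run (.d0 c) w).2 := by
  induction l with
  | nil => simp [FST.run_cons, copyStepStep]
  | cons b l ih => simp [FST.run_cons, copyStepStep, ih]

/-- Sent cells are copied. [folklore] -/
theorem copyStep_run_s0_sent (l w : List Bool) :
    (copyStep.run .s0 ((l.flatMap fun b => [true, true, b]) ++ w)).2 =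
      (l.flatMap fun b => [true, true, b]) ++ (copyStep.run .s0 w).2 := by
  induction l with
  | nil => rfl
  | cons b l ih => simp [FST.run_cons, copyStepStep, ih]

/-- **One copy round on a configuration.** [folklore] -/
theorem copyStep_eval_cfg (done rest : List Bool) :
    copyStep.eval (cfg done rest) =
      match rest with
      | [] => cfg done []
      | b :: l => cfg (done ++ [b]) l := by
  cases rest with
  | nil =>
    rw [copyStep_eval_eq, cfg, List.append_assoc, copyStep_run_s0_sent]
    simp [FST.run_cons, copyStepStep, copyStep_run_c0]
  | cons b l =>
    rw [copyStep_eval_eq, cfg, List.append_assoc, copyStep_run_s0_sent]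
    simp [FST.run_cons, copyStepStep, copyStep_run_t0, copyStep_run_d0, cfg]

/-- **`a` copy rounds** copy the first `a` symbols. [folklore] -/
theorem copyStep_iterate_cfg (a : ℕ) :
    ∀ done rest : List Bool,
      copyStep.eval^[a] (cfg done rest) = cfg (done ++ rest.take a) (rest.drop a) := by
  induction a with
  | zero => intro done rest; simp
  | succ a ih =>
    intro done rest
    cases rest with
    | nil =>
      rw [Function.iterate_succ_apply, copyStep_eval_cfg]
      simpa using ih done []
    | cons b l =>
      rw [Function.iterate_succ_apply, copyStep_eval_cfg]
      simp only [ih, List.take_succ_cons, List.drop_succ_cons, List.append_assoc,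
        List.singleton_append]

/-- Potential of a state of `copyStep`: pending (consumed, not yet emitted) symbols plus `2` as
long as an insertion may still happen. [folklore] -/
def S₃.pot : S₃ → ℕ
  | .s0 => 2
  | .s1 => 3
  | .s2 _ => 4
  | .t0 _ => 2
  | .t1 _ => 3
  | .t2 _ _ => 4
  | .c0 => 0
  | .c1 => 1
  | .d0 _ => 2
  | .d1 _ => 3
  | .fin => 0

/-- Amortised length bound: `|body| ≤ |w| + pot s` from every state `s`. [folklore] -/
theorem copyStep_length_run_le (w : List Bool) :
    ∀ s : S₃, (copyStep.run s w).2.length ≤ w.length + s.pot := by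
  induction w with
  | nil => intro s; simp
  | cons x w ih =>
    intro s
    rcases s with _ | _ | m | c | c | ⟨c, m⟩ | _ | _ | c | c | _ <;> cases x <;>
      first
      | (cases m <;> simp [FST.run_cons, copyStepStep, S₃.pot] <;>
          (first | (have := ih .s0; simp [S₃.pot] at this; omega)
                 | (have := ih (.t0 false); simp [S₃.pot] at this; omega)
                 | (have := ih (.t0 true); simp [S₃.pot] at this; omega)))
      | (simp [FST.run_cons, copyStepStep, S₃.pot];
          first
          | (have := ih .s1; simp [S₃.pot] at this; omega)
          | (have := ih .c0; simp [S₃.pot] at this; omega)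
          | (have := ih (.s2 false); simp [S₃.pot] at this; omega)
          | (have := ih (.s2 true); simp [S₃.pot] at this; omega)
          | (have := ih (.t1 c); simp [S₃.pot] at this; omega)
          | (have := ih (.d0 c); simp [S₃.pot] at this; omega)
          | (have := ih (.t2 c false); simp [S₃.pot] at this; omega)
          | (have := ih (.t2 c true); simp [S₃.pot] at this; omega)
          | (have := ih (.t0 c); simp [S₃.pot] at this; omega)
          | (have := ih .c1; simp [S₃.pot] at this; omega)
          | (have := ih .fin; simp [S₃.pot] at this; omega)
          | (have := ih (.d1 c); simp [S₃.pot] at this; omega))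

/-- `|copyStep w| ≤ |w| + 2` for every input `w` (additive growth, `d = 2`). [folklore] -/
theorem length_copyStep_eval_le (w : List Bool) : (copyStep.eval w).length ≤ w.length + 2 := by
  simpa [S₃.pot] using copyStep_length_run_le w .s0

/-- **Clocked copying is polynomial time**: `(s, a) ↦ copyStep^{a} s` on `none^{a} ++ s.map some`.
[Arora–Barak 2009, §1.4.1] [cite: AroraBarak2009, §1.4.1] -/
theorem polyTimeComputable_iterate_copyStep :
    PolyTimeComputable (fun q : List Bool × ℕ => List.replicate q.2 none ++ (id q.1).map some)
      (id : List Bool → List Bool) (fun q => copyStep.eval^[q.2] q.1) :=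
  PolyTimeComputable.iterate_of_le_add (ea := (id : List Bool → List Bool)) 2
    (fun w => by simpa using length_copyStep_eval_le w) copyStep.polyTimeComputable_eval

/-! ### Stage 4: decoding the final configuration, `copyOut` -/

/-- States of `copyOut`: source-cell reader (`g0`, `g1`, `g2`), copy-cell reader (`h0`, `h1`), and
the final state. [folklore] -/
inductive S₄
  | g0
  | g1
  | g2
  | h0
  | h1
  | fin
  deriving DecidableEq, Fintype

/-- Transition function of `copyOut`: source cell `1 m b ↦ b b`, marker `0 ↦ 0 1`, copy cell
`1 b ↦ b`, end marker `0 ↦ []`. [folklore] -/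
def copyOutStep : S₄ → Bool → S₄ × List Bool
  | .g0, true => (.g1, [])
  | .g0, false => (.h0, [false, true])
  | .g1, _ => (.g2, [])
  | .g2, b => (.g0, [b, b])
  | .h0, true => (.h1, [])
  | .h0, false => (.fin, [])
  | .h1, b => (.h0, [b])
  | .fin, _ => (.fin, [])

/-- The decoding transducer `cfg done rest ↦ ⟨done ++ rest, done⟩`. [folklore] -/
def copyOut : FST S₄ Bool Bool where
  init := .g0
  step := copyOutStep
  front := fun _ => []
  keep := fun _ => true

/-- The transition of `copyOut` is `copyOutStep` (definitional). [folklore] -/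
@[simp] theorem copyOut_step (s : S₄) (b : Bool) : copyOut.step s b = copyOutStep s b := rfl

/-- Copy cells are decoded and the end marker dropped. [folklore] -/
theorem copyOut_run_h0 (l : List Bool) :
    (copyOut.run .h0 ((l.flatMap fun b => [true, b]) ++ [false])).2 = l := by
  induction l with
  | nil => simp [FST.run_cons, copyOutStep]
  | cons b l ih => simp [FST.run_cons, copyOutStep, ih]

/-- Source cells are decoded as doubled symbols, whatever their mark. [folklore] -/
theorem copyOut_run_g0 (m : Bool) (l w : List Bool) :
    (copyOut.run .g0 ((l.flatMap fun b => [true, m, b]) ++ w)).2 =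
      dup l ++ (copyOut.run .g0 w).2 := by
  induction l with
  | nil => rfl
  | cons b l ih => simp [FST.run_cons, copyOutStep, ih, dup]

/-- **Decoding a configuration**: `copyOut (cfg done rest) = ⟨done ++ rest, done⟩`. [folklore] -/
theorem copyOut_eval_cfg (done rest : List Bool) :
    copyOut.eval (cfg done rest) = boolPair (done ++ rest) done := by
  have he : copyOut.eval (cfg done rest) = (copyOut.run .g0 (cfg done rest)).2 := by
    simp [FST.eval, copyOut]
  rw [he, cfg, List.append_assoc, copyOut_run_g0, copyOut_run_g0]
  simp [FST.run_cons, copyOutStep, copyOut_run_h0, boolPair_eq_dup, dup]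

end StrCopy

open StrCopy

/-! ### The copy map -/

/-- **The copy map** `copyFn`, a total string function with `copyFn z = ⟨z, z⟩` (`copyFn_apply`):
end-mark, clock, recode, `|z|` copy rounds, decode. [Arora–Barak 2009, §1.3] [cite: AroraBarak2009, §1.3] -/
noncomputable def copyFn : List Bool → List Bool :=
  copyOut.eval ∘ (fun s : List Bool × ℕ => copyStep.eval^[s.2] s.1) ∘ stage2 ∘ initFn ∘ rePair ∘ dup

/-- **`copyFn z = ⟨z, z⟩`.** [Arora–Barak 2009, §1.3] [cite: AroraBarak2009, §1.3] -/
theorem copyFn_apply (z : List Bool) : copyFn z = boolPair z z := by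
  simp only [copyFn, Function.comp_apply, rePair_dup, initFn, boolUnpair_boolPair, stage2_hdr,
    copyStep_iterate_cfg, List.nil_append, List.take_length, List.drop_length, copyOut_eval_cfg,
    List.append_nil]

/-- **The copy map is in `FP`** (composition of the six polynomial-time stages).
[Arora–Barak 2009, §1.3, Thm. 2.8 (proof: composition)] [cite: AroraBarak2009, §1.3] -/
theorem copyFn_mem_FP : copyFn ∈ FP :=
  PolyTimeComputable.comp_holds copyOut.polyTimeComputable_eval
    (PolyTimeComputable.comp_holds polyTimeComputable_iterate_copyStep
      (PolyTimeComputable.comp_holds polyTimeComputable_stage2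
        (PolyTimeComputable.comp_holds initFn_mem_FP
          (PolyTimeComputable.comp_holds rePair_mem_FP dup_mem_FP))))

/-! ### Indicator functions and the selector transducer -/

/-- For `L ∈ P`, the string-valued indicator `x ↦ encodeBool [x ∈ L]` is in `FP` (the deciding
machine itself). [Arora–Barak 2009, Def. 1.13] [cite: AroraBarak2009, Def. 1.13] -/
theorem indicatorFn_mem_FP {L : Language Bool} (hL : L ∈ Classes.P) :
    (fun x => encodeBool (L.boolIndicator x)) ∈ FP := by
  obtain ⟨p, M, hM⟩ := polyTimeDecidable_iff.1 (mem_P_iff_holds.1 hL)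
  exact ⟨p, M, fun x => hM x⟩

namespace StrCopy

/-- States of the selector: reading the doubled indicator bit and the separator, then copying or
having decided for the constant. [folklore] -/
inductive S₅
  | a0
  | a1 (b : Bool)
  | a2 (c : Bool)
  | a3 (c : Bool)
  | copy
  | konst
  | junk
  deriving DecidableEq, Fintype

/-- Transition function of the selector `sel copyOn s`: on `⟨[c], w⟩ = c c 0 1 w`, copy `w` if
`c = copyOn`, otherwise emit nothing (the constant `s` is produced by `front`/`keep`). [folklore] -/
def selStep (copyOn : Bool) : S₅ → Bool → S₅ × List Bool
  | .a0, b => (.a1 b, [])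
  | .a1 b, b' => if b = b' then (.a2 b, []) else (.junk, [])
  | .a2 c, false => (.a3 c, [])
  | .a2 _, true => (.junk, [])
  | .a3 c, true => (if c = copyOn then .copy else .konst, [])
  | .a3 _, false => (.junk, [])
  | .copy, b => (.copy, [b])
  | .konst, _ => (.konst, [])
  | .junk, _ => (.junk, [])

/-- The selector transducer: `⟨[c], w⟩ ↦ w` if `c = copyOn`, `↦ s` otherwise. [folklore] -/
def sel (copyOn : Bool) (s : List Bool) : FST S₅ Bool Bool where
  init := .a0
  step := selStep copyOn
  front := fun st => if st = .konst then s else []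
  keep := fun st => st != .konst

/-- The transition of `sel` is `selStep` (definitional). [folklore] -/
@[simp] theorem sel_step (copyOn : Bool) (s : List Bool) (st : S₅) (b : Bool) :
    (sel copyOn s).step st b = selStep copyOn st b := rfl

/-- The transduction of `sel`: the constant `s` if the run ends in `konst`, the emitted body
otherwise. [folklore] -/
theorem sel_eval_eq (copyOn : Bool) (s w : List Bool) :
    (sel copyOn s).eval w =
      if ((sel copyOn s).run .a0 w).1 = .konst then s else ((sel copyOn s).run .a0 w).2 := by
  simp only [FST.eval, sel]
  split <;> simp_all

/-- The copier of `sel` copies and stays in `copy`. [folklore] -/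
theorem sel_run_copy (copyOn : Bool) (s w : List Bool) :
    (sel copyOn s).run .copy w = (.copy, w) := by
  induction w with
  | nil => rfl
  | cons b w ih => simp [FST.run_cons, selStep, ih]

/-- The constant state of `sel` emits nothing and stays. [folklore] -/
theorem sel_run_konst (copyOn : Bool) (s w : List Bool) :
    (sel copyOn s).run .konst w = (.konst, []) := by
  induction w with
  | nil => rfl
  | cons b w ih => simp [FST.run_cons, selStep, ih]

/-- **The selector on `⟨[c], w⟩`**: `w` if `c = copyOn`, else the constant `s`. [folklore] -/
theorem sel_eval (copyOn c : Bool) (s w : List Bool) :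
    (sel copyOn s).eval (boolPair [c] w) = if c = copyOn then w else s := by
  have hin : boolPair [c] w = c :: c :: false :: true :: w := by simp [boolPair]
  rw [sel_eval_eq, hin]
  by_cases h : c = copyOn
  · simp [FST.run_cons, selStep, h, sel_run_copy]
  · simp [FST.run_cons, selStep, h, sel_run_konst]

end StrCopy

/-- The selector map is in `FP`. [folklore] -/
theorem sel_mem_FP (copyOn : Bool) (s : List Bool) : (StrCopy.sel copyOn s).eval ∈ FP :=
  (StrCopy.sel copyOn s).polyTimeComputable_eval

/-! ### Closure under intersection and union with `P` languages -/

/-- **Intersection with a `P` language.** If `K` is closed under polynomial-time preimages and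
contains `P`, then `L₁ ∈ P`, `L₂ ∈ K` give `L₁ ⊓ L₂ ∈ K` (`⊓ = ∩` on `Language _ = Set _`): unless `L₂` is everything (then
`L₁ ∩ L₂ = L₁ ∈ P ⊆ K`), pick `s ∉ L₂`; then
`L₁ ∩ L₂ = (sel ∘ mapFst χ₁ ∘ copy)⁻¹(L₂)` where the map sends `x` to `x` if `x ∈ L₁` and to `s`
otherwise. [Arora–Barak 2009, §1.3 (running two machines), Thm. 2.8] [cite: AroraBarak2009, Thm. 2.8] -/
theorem inter_mem_of_preimage_closed {K : Set (Language Bool)}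
    (hK : ∀ ⦃L : Language Bool⦄, L ∈ K → ∀ ⦃g : List Bool → List Bool⦄, g ∈ FP → g ⁻¹' L ∈ K)
    (hPK : Classes.P ⊆ K) {L₁ L₂ : Language Bool} (h₁ : L₁ ∈ Classes.P) (h₂ : L₂ ∈ K) : L₁ ⊓ L₂ ∈ K := by
  by_cases huniv : ∀ s : List Bool, s ∈ L₂
  · have : L₁ ⊓ L₂ = L₁ := inf_eq_left.2 fun x _ => huniv x
    rw [this]
    exact hPK h₁
  push Not at huniv
  obtain ⟨s, hs⟩ := huniv
  set g : List Bool → List Bool :=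
    (StrCopy.sel true s).eval ∘ mapFstFn (fun x => encodeBool (L₁.boolIndicator x)) ∘ copyFn
    with hg
  have hgFP : g ∈ FP :=
    comp_mem_FP (sel_mem_FP true s) (comp_mem_FP (mapFstFn_mem_FP (indicatorFn_mem_FP h₁))
      copyFn_mem_FP)
  have hgx : ∀ x, g x = if L₁.boolIndicator x = true then x else s := fun x => by
    simp only [hg, Function.comp_apply, copyFn_apply, mapFstFn_boolPair]
    exact StrCopy.sel_eval true (L₁.boolIndicator x) s x
  have hset : L₁ ⊓ L₂ = g ⁻¹' L₂ := by
    ext x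
    change x ∈ L₁ ∧ x ∈ L₂ ↔ g x ∈ L₂
    rw [hgx x]
    by_cases hx : x ∈ L₁
    · rw [(Set.mem_iff_boolIndicator _ _).1 hx, if_pos rfl]
      exact ⟨fun h => h.2, fun h => ⟨hx, h⟩⟩
    · rw [(Set.notMem_iff_boolIndicator _ _).1 hx]
      simp only [Bool.false_eq_true, if_false]
      exact ⟨fun h => absurd h.1 hx, fun h => absurd h hs⟩
  rw [hset]
  exact hK h₂ hgFP

/-- **Union with a `P` language.** If `K` is closed under polynomial-time preimages and contains
`P`, then `L₁ ∈ P`, `L₂ ∈ K` give `L₁ ⊔ L₂ ∈ K` (`⊔ = ∪`; dually: send `x ∈ L₁` to a fixed `s ∈ L₂`).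
[Arora–Barak 2009, §1.3, Thm. 2.8] [cite: AroraBarak2009, Thm. 2.8] -/
theorem union_mem_of_preimage_closed {K : Set (Language Bool)}
    (hK : ∀ ⦃L : Language Bool⦄, L ∈ K → ∀ ⦃g : List Bool → List Bool⦄, g ∈ FP → g ⁻¹' L ∈ K)
    (hPK : Classes.P ⊆ K) {L₁ L₂ : Language Bool} (h₁ : L₁ ∈ Classes.P) (h₂ : L₂ ∈ K) : L₁ ⊔ L₂ ∈ K := by
  by_cases hemp : ∀ s : List Bool, s ∉ L₂
  · have : L₁ ⊔ L₂ = L₁ := sup_eq_left.2 fun x hx => absurd hx (hemp x)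
    rw [this]
    exact hPK h₁
  push Not at hemp
  obtain ⟨s, hs⟩ := hemp
  set g : List Bool → List Bool :=
    (StrCopy.sel false s).eval ∘ mapFstFn (fun x => encodeBool (L₁.boolIndicator x)) ∘ copyFn
    with hg
  have hgFP : g ∈ FP :=
    comp_mem_FP (sel_mem_FP false s) (comp_mem_FP (mapFstFn_mem_FP (indicatorFn_mem_FP h₁))
      copyFn_mem_FP)
  have hgx : ∀ x, g x = if L₁.boolIndicator x = false then x else s := fun x => by
    simp only [hg, Function.comp_apply, copyFn_apply, mapFstFn_boolPair]
    exact StrCopy.sel_eval false (L₁.boolIndicator x) s x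
  have hset : L₁ ⊔ L₂ = g ⁻¹' L₂ := by
    ext x
    change x ∈ L₁ ∨ x ∈ L₂ ↔ g x ∈ L₂
    rw [hgx x]
    by_cases hx : x ∈ L₁
    · rw [(Set.mem_iff_boolIndicator _ _).1 hx]
      simp only [Bool.true_eq_false, if_false]
      exact ⟨fun _ => hs, fun _ => Or.inl hx⟩
    · rw [(Set.notMem_iff_boolIndicator _ _).1 hx, if_pos rfl]
      exact ⟨fun h => h.resolve_left hx, fun h => Or.inr h⟩
  rw [hset]
  exact hK h₂ hgFP

/-- **`P` is closed under intersection** (`⊓ = ∩` on languages). [Arora–Barak 2009, §1.3, Claim 1.6] [cite: AroraBarak2009, Thm. 2.8] -/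
theorem inter_mem_P {L₁ L₂ : Language Bool} (h₁ : L₁ ∈ Classes.P) (h₂ : L₂ ∈ Classes.P) : L₁ ⊓ L₂ ∈ Classes.P :=
  inter_mem_of_preimage_closed (fun _ hL _ hg => preimage_mem_P hL hg) le_rfl h₁ h₂

/-- **`P` is closed under union** (`⊔ = ∪` on languages). [Arora–Barak 2009, §1.3, Claim 1.6] [cite: AroraBarak2009, Thm. 2.8] -/
theorem union_mem_P {L₁ L₂ : Language Bool} (h₁ : L₁ ∈ Classes.P) (h₂ : L₂ ∈ Classes.P) : L₁ ⊔ L₂ ∈ Classes.P :=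
  union_mem_of_preimage_closed (fun _ hL _ hg => preimage_mem_P hL hg) le_rfl h₁ h₂

end Literature.Computability.Complexity
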